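import Summits.NavierStokesRegularity.NavierStokesRegularity.Theorems.FrozenSignCascadeBoundedEnvelopeContinuationLiouvilleMorreyOfNoLocalTypeI
import Summits.NavierStokesRegularity.NavierStokesRegularity.Theorems.FrozenSignCascadeBoundedEnvelopeContinuationAxisDecay
import Summits.NavierStokesRegularity.NavierStokesRegularity.Theorems.FrozenSignCascadeBoundedEnvelopeContinuationLiouvilleMorreyOfL
import Summits.NavierStokesRegularity.NavierStokesRegularity.Theorems.RellichScarScarRigidityApexBounds
import Literature.Analysis.FluidPDE.KNSSTypeIRateLiouvilleMild
import Literature.Analysis.FluidPDE.KNSSThm53OfWindow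
import Literature.Analysis.FluidPDE.KNSSLiouville
import Literature.Analysis.FluidPDE.LocalTypeIScaling
import HarnessLib

/-!
# Route FrozenSignCascade · crux `BoundedEnvelopeContinuation` — the open stub (L_M) holds in the
# AXISYMMETRIC class

Helper file for the crux item stmt-NavierStokesRegularity-10579 (`BoundedEnvelopeContinuation`,
conjunct (B) of route `FrozenSignCascade`), line `registered`; lands `--supports` that item.

The registered open stub of the line is the Liouville statement

  (L_M)  a bounded ancient mild solution `v` (`ν = 1`), jointly smooth and Oseen-mild on
         `(-∞,0) × ℝ³`, with the scale-invariant Morrey bound `∫_{B_r(y)} ‖v t‖² ≤ M' r` at all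
         radii, vanishes identically

(Type-I exclusion in Liouville form, open). This file proves it for AXISYMMETRIC `v`
(`liouvilleMorrey_axisymmetric`), complementing the small-constant case
`liouvilleMorrey_small` (p160131):

1. `v` has a classical pressure `P` (`HardyAncientLimit.exists_isClassicalNSSolutionOn_Iio_of_oseen`)
   and a finite Albritton–Barker Type-I quantity `𝐈 = typeIBound ((-∞,0) × ℝ³) v P ∇v < ∞`
   (`typeIBound_slab_lt_top_of_morrey`, p156156: the Morrey bound at all radii bootstraps to
   `A + C + D + E` bounded on every past parabolic ball).
2. For every `λ > 0` the Navier–Stokes zoom `v_λ(s,y) = λ v(λ² s, λ y)` is again classical,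
   axisymmetric, with `𝐈(Q(0,5); v_λ) ≤ 𝐈` (scale invariance, `typeIBound_nsZoom`), so the
   unit-scale axis-decay estimate `axisDecay_core` (p165542: Seregin–Zajaczkowski 2007 Prop. 4.1
   on every shell, fed by `𝐈`) gives `|y'| ‖v_λ(s,y)‖ ≤ (3/2) Ψ(𝐈)` on the unit Seregin–Šverák
   cylinder; un-zooming with `λ → ∞` yields the GLOBAL axis decay `|x'| ‖v(t,x)‖ ≤ (3/2) Ψ(𝐈)`.
3. Koch–Nadirashvili–Seregin–Šverák 2009, Thm. 5.3 (`KNSS2009_liouville_bound_C_over_r_holds`):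
   a bounded ancient weak solution, axisymmetric, with `|x'| |v| ≤ C`, is a.e. zero; continuity
   upgrades this to `v ≡ 0` on the open past.

`liouvilleMorrey_axisymmetric_of` takes the single-shell sup bound (registered stub
`shellSupBound_of_abScaledSum`) as a hypothesis; `liouvilleMorrey_axisymmetric` discharges it.

## References

* G. Koch, N. Nadirashvili, G. Seregin, V. Šverák, Acta Math. 203 (2009), Thm. 5.3, §1 (L).
  [KochNadirashviliSereginSverak2009]
* G. Seregin, V. Šverák, Comm. PDE 34 (2009) = arXiv:0804.1803, Prop. 3.7. [SereginSverak2009]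
* G. Seregin, W. Zajaczkowski, SIAM J. Math. Anal. 39 (2007), Prop. 4.1. [SereginZajaczkowski2007]
* D. Albritton, T. Barker, J. Math. Fluid Mech. 21 (2019), Lemma 2.6. [AlbrittonBarker2019]
-/

noncomputable section

set_option linter.dupNamespace false -- nested layout Summit.<S>.<Sub>, Sub = S (D-0017)

open Set MeasureTheory Filter Topology Metric Function
open scoped ENNReal NNReal
open Literature.Analysis Literature.Analysis.FluidPDE
open Literature.Analysis.FluidPDE.SereginSverak2009 Literature.Analysis.FluidPDE.SereginZajaczkowski2007

namespace Summit.NavierStokesRegularity.NavierStokesRegularity.Theorems.BoundedEnvelope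

/-! ### Zooms about the origin of a classical axisymmetric ancient solution -/

/-- The Navier–Stokes zoom about the space–time origin of a field with axisymmetric slices on
the open past has axisymmetric slices on the open past (`rotZ θ` is linear and the zoom is
centred on the axis). [folklore] -/
theorem isAxisymmetric_zoom_origin {v : ℝ → EuclideanSpace ℝ (Fin 3) → EuclideanSpace ℝ (Fin 3)}
    (haxi : ∀ t < 0, IsAxisymmetric (v t)) {c : ℝ} (hc : 0 < c) {s : ℝ} (hs : s < 0) :
    IsAxisymmetric ((c • stPull (c ^ 2) c 0 0 v) s) := by
  intro θ y
  have hs' : c ^ 2 * s < 0 := mul_neg_of_pos_of_neg (pow_pos hc 2) hs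
  have h1 : (c • stPull (c ^ 2) c 0 0 v) s (rotZ θ y) = c • v (0 + c ^ 2 * s) (0 + c • rotZ θ y) := by
    rw [smul_stPull_apply]
  have h2 : (c • stPull (c ^ 2) c 0 0 v) s y = c • v (0 + c ^ 2 * s) (0 + c • y) := by
    rw [smul_stPull_apply]
  rw [h1, h2]
  simp only [zero_add]
  have hlin : c • rotZ θ y = rotZ θ (c • y) := by
    rw [← rotZLIE_apply, ← rotZLIE_apply, LinearIsometryEquiv.map_smul]
  rw [hlin, haxi _ hs' θ (c • y), ← rotZLIE_apply, ← rotZLIE_apply, LinearIsometryEquiv.map_smul]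

/-- **Global axis decay from the Type-I quantity of the whole past.** If `(v, P)` is a classical
axisymmetric solution (`ν = 1`) on `(-∞,0) × ℝ³` with
`typeIBound ((-∞,0) × ℝ³) v P ∇v ≤ K`, then, given the single-shell sup bound `hΨ`
(Seregin–Zajaczkowski 2007, Prop. 4.1 at unit scale), `|x'| ‖v(t,x)‖ ≤ (3/2) Ψ K` for all
`t < 0` and all `x`: apply `axisDecay_core` to the zoom `v_λ(s,y) = λ v(λ² s, λ y)` with `λ` so
large that `(t/λ², x/λ)` lies in the unit Seregin–Šverák cylinder.
[cite: SereginSverak2009, Prop. 3.7; SereginZajaczkowski2007, Prop. 4.1] -/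
theorem axisDecay_global_of_typeIBound {Ψ : ℝ≥0 → ℝ≥0}
    (hΨ : ∀ (W : ℝ → EuclideanSpace ℝ (Fin 3) → EuclideanSpace ℝ (Fin 3))
      (P : ℝ → EuclideanSpace ℝ (Fin 3) → ℝ),
      IsClassicalNSSolutionOn (Set.Ioo (-16) 0) 1 0 W P →
      (∀ t ∈ Set.Ioo (-16 : ℝ) 0, IsAxisymmetric (W t)) →
      ∀ K : ℝ≥0, abScaledSum 4 ((0 : ℝ), (0 : EuclideanSpace ℝ (Fin 3))) W P
          (fun t x => fderiv ℝ (W t) x) ≤ K →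
        ∀ z ∈ shellCyl 1 2 1 1, ‖W z.1 z.2‖ ≤ Ψ K)
    {v : ℝ → EuclideanSpace ℝ (Fin 3) → EuclideanSpace ℝ (Fin 3)}
    {P : ℝ → EuclideanSpace ℝ (Fin 3) → ℝ}
    (hcl : IsClassicalNSSolutionOn (Iio 0) 1 0 v P) (haxi : ∀ t < 0, IsAxisymmetric (v t))
    {K : ℝ≥0}
    (hK : typeIBound (Iio (0 : ℝ) ×ˢ (univ : Set (EuclideanSpace ℝ (Fin 3)))) v P
      (fun t x => fderiv ℝ (v t) x) ≤ K)
    {t : ℝ} (ht : t < 0) (x : EuclideanSpace ℝ (Fin 3)) :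
    cylRadius x * ‖v t x‖ ≤ 3 / 2 * Ψ K := by
  by_cases hx0 : cylRadius x = 0
  · rw [hx0, zero_mul]; positivity
  have hρ0 : 0 < cylRadius x := lt_of_le_of_ne (cylRadius_nonneg x) (Ne.symm hx0)
  -- the zoom factor
  set μ : ℝ := max (max (cylRadius x) |x 2|) (Real.sqrt (-t)) + 1 with hμdef
  have hμ1 : cylRadius x < μ := by
    have : cylRadius x ≤ max (max (cylRadius x) |x 2|) (Real.sqrt (-t)) :=
      (le_max_left _ _).trans (le_max_left _ _)
    linarith
  have hμ2 : |x 2| < μ := by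
    have : |x 2| ≤ max (max (cylRadius x) |x 2|) (Real.sqrt (-t)) :=
      (le_max_right _ _).trans (le_max_left _ _)
    linarith
  have hμ3 : Real.sqrt (-t) < μ := by
    have : Real.sqrt (-t) ≤ max (max (cylRadius x) |x 2|) (Real.sqrt (-t)) := le_max_right _ _
    linarith
  have hμ : 0 < μ := hρ0.trans hμ1
  have hμt : -t < μ ^ 2 := by
    have h0 : 0 ≤ -t := by linarith
    have h1 : Real.sqrt (-t) ^ 2 = -t := Real.sq_sqrt h0
    nlinarith [Real.sqrt_nonneg (-t)]
  -- the zoom and its data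
  set w : ℝ → EuclideanSpace ℝ (Fin 3) → EuclideanSpace ℝ (Fin 3) := μ • stPull (μ ^ 2) μ 0 0 v
    with hwdef
  set ϖ : ℝ → EuclideanSpace ℝ (Fin 3) → ℝ := μ ^ 2 • stPull (μ ^ 2) μ 0 0 P with hϖdef
  have hclw : IsClassicalNSSolutionOn (Iio 0) 1 0 w ϖ :=
    RellichScarScarRigidity.isClassicalNSSolutionOn_zoom hcl hμ
  have hclw' : IsClassicalNSSolutionOn (Set.Ioo (-25) 0) 1 0 w ϖ :=
    hclw.mono Ioo_subset_Iio_self (uniqueDiffOn_Ioo _ _)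
  have haxiw : ∀ s ∈ Set.Ioo (-25 : ℝ) 0, IsAxisymmetric (w s) := fun s hs =>
    isAxisymmetric_zoom_origin haxi hμ hs.2
  -- the Type-I quantity of the zoom on `Q(0,5)` is at most `K`
  have hKw : typeIBound (parabolicCylinder 5 ((0 : ℝ), (0 : EuclideanSpace ℝ (Fin 3)))) w ϖ
      (fun s y => fderiv ℝ (w s) y) ≤ K := by
    rw [hwdef, fderiv_nsZoom_eq μ 0 0 v]
    have hpre : stAffine (μ ^ 2) μ 0 (0 : EuclideanSpace ℝ (Fin 3)) ⁻¹'
        parabolicCylinder (μ * 5) (stAffine (μ ^ 2) μ 0 (0 : EuclideanSpace ℝ (Fin 3)) 0) =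
        parabolicCylinder 5 ((0 : ℝ), (0 : EuclideanSpace ℝ (Fin 3))) :=
      LocalTypeIScaling.stAffine_preimage_parabolicCylinder hμ 0 0 5 0
    rw [← hpre, typeIBound_nsZoom hμ 0 0 _ v P (fun t x => fderiv ℝ (v t) x)]
    refine le_trans (typeIBound_mono fun z hz => ?_) hK
    have h0 : stAffine (μ ^ 2) μ 0 (0 : EuclideanSpace ℝ (Fin 3)) 0 = 0 := by
      simp [stAffine]
    rw [h0, mem_parabolicCylinder] at hz
    exact ⟨by simpa using hz.1.2, mem_univ _⟩
  -- the unit-scale axis decay for the zoom at the point `(t/μ², x/μ)`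
  have hs1 : -1 < t / μ ^ 2 := by
    rw [lt_div_iff₀ (by positivity)]; linarith
  have hs2 : t / μ ^ 2 < 0 := div_neg_of_neg_of_pos ht (by positivity)
  have hρ1 : cylRadius (μ⁻¹ • x) < 1 := by
    rw [cylRadius_smul, abs_of_pos (inv_pos.2 hμ), inv_mul_lt_iff₀ hμ]; linarith
  have hρ0' : 0 < cylRadius (μ⁻¹ • x) := by
    rw [cylRadius_smul, abs_of_pos (inv_pos.2 hμ)]; positivity
  have hy2 : |(μ⁻¹ • x) 2| < 1 := by
    rw [PiLp.smul_apply, smul_eq_mul, abs_mul, abs_of_pos (inv_pos.2 hμ), inv_mul_lt_iff₀ hμ]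
    linarith
  have key := axisDecay_core hΨ hclw' haxiw hKw hs1 hs2 hρ1 hρ0' hy2
  -- un-zoom
  have hval : w (t / μ ^ 2) (μ⁻¹ • x) = μ • v t x := by
    rw [hwdef, smul_stPull_apply, zero_add, zero_add, smul_inv_smul₀ hμ.ne',
      mul_div_cancel₀ _ (by positivity)]
  rw [hval, cylRadius_smul, abs_of_pos (inv_pos.2 hμ), norm_smul, Real.norm_of_nonneg hμ.le]
    at key
  calc cylRadius x * ‖v t x‖ = μ⁻¹ * cylRadius x * (μ * ‖v t x‖) := by field_simp
    _ ≤ 3 / 2 * Ψ K := key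

/-! ### The Liouville theorem -/

/-- **(L_M) in the axisymmetric class, from the single-shell sup bound.** Given the unit-scale
sup bound `hΨ` (registered stub `shellSupBound_of_abScaledSum`), a bounded ancient mild solution
`v` (`ν = 1`), jointly smooth and Oseen-mild on `(-∞,0) × ℝ³`, with the Morrey bound
`∫_{B_r(y)} ‖v t‖² ≤ M' r` at all radii and AXISYMMETRIC slices, vanishes identically: its
Type-I quantity of the whole past is finite (`typeIBound_slab_lt_top_of_morrey`), so
`axisDecay_global_of_typeIBound` gives `|x'| ‖v‖ ≤ C`, and KNSS 2009 Thm. 5.3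
(`KNSS2009_liouville_bound_C_over_r_holds`) kills `v` almost everywhere, hence everywhere by
continuity. [cite: KochNadirashviliSereginSverak2009, Thm. 5.3] -/
theorem liouvilleMorrey_axisymmetric_of :
    (∃ Ψ : ℝ≥0 → ℝ≥0, Monotone Ψ ∧
      ∀ (W : ℝ → EuclideanSpace ℝ (Fin 3) → EuclideanSpace ℝ (Fin 3))
        (P : ℝ → EuclideanSpace ℝ (Fin 3) → ℝ),
        Literature.Analysis.FluidPDE.IsClassicalNSSolutionOn (Set.Ioo (-16) 0) 1 0 W P →
        (∀ t ∈ Set.Ioo (-16 : ℝ) 0, Literature.Analysis.FluidPDE.IsAxisymmetric (W t)) →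
        ∀ K : ℝ≥0,
          Literature.Analysis.FluidPDE.abScaledSum 4 ((0 : ℝ), (0 : EuclideanSpace ℝ (Fin 3))) W P
              (fun t x => fderiv ℝ (W t) x) ≤ K →
          ∀ z ∈ Literature.Analysis.FluidPDE.SereginZajaczkowski2007.shellCyl 1 2 1 1,
            ‖W z.1 z.2‖ ≤ Ψ K) →
    ∀ v : ℝ → EuclideanSpace ℝ (Fin 3) → EuclideanSpace ℝ (Fin 3),
      Literature.Analysis.FluidPDE.IsBoundedAncientMildSolution 1 v →
      ContDiffOn ℝ (⊤ : ℕ∞) (uncurry v) (Set.Iio 0 ×ˢ Set.univ) →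
      (∀ s t : ℝ, s < t → t < 0 → ∀ x,
        v t x = UnboundedOperators.heatExtension (v s) (t - s) x -
          Literature.Analysis.FluidPDE.oseenDuhamel 1 s v v t x) →
      (∃ M' : ℝ, ∀ t < 0, ∀ (y : EuclideanSpace ℝ (Fin 3)) (r : ℝ), 0 < r →
        ∫ x in Metric.ball y r, ‖v t x‖ ^ 2 ≤ M' * r) →
      (∀ t < 0, Literature.Analysis.FluidPDE.IsAxisymmetric (v t)) →
      ∀ t < 0, ∀ x, v t x = 0 := by
  rintro ⟨Ψ, -, hΨ⟩ v hmild hsm hoseen hMor haxi t ht x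
  obtain ⟨M', hM'⟩ := hMor
  -- non-negative constants
  set M : ℝ := max M' 0 with hMdef
  have hM0 : 0 ≤ M := le_max_right _ _
  have hMorM : ∀ t < 0, ∀ (y : EuclideanSpace ℝ (Fin 3)) (r : ℝ), 0 < r →
      ∫ x in ball y r, ‖v t x‖ ^ 2 ≤ M * r :=
    fun t ht y r hr => (hM' t ht y r hr).trans (mul_le_mul_of_nonneg_right (le_max_left _ _) hr.le)
  obtain ⟨V', hV'⟩ := hmild.2
  set V : ℝ := max V' 0 with hVdef
  have hV0 : 0 ≤ V := le_max_right _ _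
  have hbd : ∀ t < 0, ∀ x, ‖v t x‖ ≤ V := fun t ht x => (hV' t ht x).trans (le_max_left _ _)
  have hcont : ContinuousOn (uncurry v) (Iio (0 : ℝ) ×ˢ univ) := hsm.continuousOn
  -- the classical pressure and the Type-I quantity of the whole past
  obtain ⟨P, hcl⟩ :=
    HardyAncientLimit.exists_isClassicalNSSolutionOn_Iio_of_oseen hcont hV0 hbd hmild.1 hoseen
  have hI := typeIBound_slab_lt_top_of_morrey hM0 hV0 hcl hMorM hbd
  set K : ℝ≥0 := (typeIBound (Iio (0 : ℝ) ×ˢ (univ : Set (EuclideanSpace ℝ (Fin 3)))) v P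
    (fun t x => fderiv ℝ (v t) x)).toNNReal with hKdef
  have hK : typeIBound (Iio (0 : ℝ) ×ˢ (univ : Set (EuclideanSpace ℝ (Fin 3)))) v P
      (fun t x => fderiv ℝ (v t) x) ≤ K := by
    rw [hKdef, ENNReal.coe_toNNReal hI.ne]
  -- global axis decay
  have hdecay : ∀ s < 0, ∀ y, cylRadius y * ‖v s y‖ ≤ 3 / 2 * Ψ K := fun s hs y =>
    axisDecay_global_of_typeIBound hΨ hcl haxi hK hs y
  -- KNSS 2009, Thm 5.3
  have hweak : IsBoundedWeakNSSolutionOn (Iio 0) isOpen_Iio 1 v :=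
    isBoundedWeakNSSolutionOn_of_oseen one_pos hcont ⟨V, hbd⟩ (fun s hs => hmild.1.1 s hs)
      (fun s s' hss' hs' y => by rw [one_mul]; exact hoseen s s' hss' hs' y)
  have hae : ∀ᵐ s ∂(volume.restrict (Iio (0 : ℝ))), v s =ᵐ[volume] 0 :=
    KNSS2009_liouville_bound_C_over_r_holds hweak (ae_rotZ_of_isAxisymmetric haxi)
      ⟨3 / 2 * Ψ K, ae_cylRadius_mul_norm_le_of_forall hdecay⟩
  -- continuity: a.e.-zero slices of a jointly continuous field on the open past are all zero
  by_contra hx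
  have hpt : ContinuousWithinAt (uncurry v) (Iio (0 : ℝ) ×ˢ univ) (t, x) := hcont (t, x) ⟨ht, mem_univ _⟩
  have hopen : IsOpen (Iio (0 : ℝ) ×ˢ (univ : Set (EuclideanSpace ℝ (Fin 3)))) :=
    isOpen_Iio.prod isOpen_univ
  have hca : ContinuousAt (uncurry v) (t, x) := hpt.continuousAt (hopen.mem_nhds ⟨ht, mem_univ _⟩)
  have hne : ∀ᶠ z in 𝓝 (t, x), uncurry v z ≠ 0 :=
    hca.eventually_ne (by simpa using hx)
  obtain ⟨δ, hδ, hball⟩ := Metric.eventually_nhds_iff.1 hne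
  -- a good time in `(t - δ', t)`, `δ' = min δ (something)`: slices there are a.e. zero but
  -- nonzero at `x`
  set I : Set ℝ := Ioo (t - δ / 2) t with hIdef
  have hIsub : I ⊆ Iio 0 := fun s hs => hs.2.trans ht
  have haeI : ∀ᵐ s ∂(volume.restrict I), v s =ᵐ[volume] 0 :=
    ae_restrict_of_ae_restrict_of_subset hIsub hae
  have hIpos : volume I ≠ 0 := by
    rw [hIdef, Real.volume_Ioo]; simp [hδ]
  haveI : NeZero (volume.restrict I) := ⟨by rwa [Ne, Measure.restrict_eq_zero]⟩
  obtain ⟨s, hs0, hsI⟩ := (haeI.and (ae_restrict_mem measurableSet_Ioo)).exists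
  have hs : s < 0 := hIsub hsI
  -- the slice at `s` is continuous and a.e. zero, hence zero
  have hcs : Continuous (v s) := continuous_slice_of_contDiffOn_past hsm hs
  have hzero : v s = fun _ => 0 := (hcs.ae_eq_iff_eq volume continuous_const).1 hs0
  -- but `(s, x)` is `δ`-close to `(t, x)`
  have hdist : dist (s, x) (t, x) < δ := by
    rw [Prod.dist_eq, dist_self, max_eq_left dist_nonneg, Real.dist_eq]
    · have h1 : t - δ / 2 < s := hsI.1
      have h2 : s < t := hsI.2
      rw [abs_sub_lt_iff]; constructor <;> linarith
  have := hball hdist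
  simp [uncurry, hzero] at this

end Summit.NavierStokesRegularity.NavierStokesRegularity.Theorems.BoundedEnvelope

end
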